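import Summits.ValiantsHypothesis.ValiantsHypothesis.Theorems.SymPencilPerFourInnerRankPureReduction

/-!
# Route `SymPencil` — inner rank of the `2 | 2` row split of `per_4`: CAPSTONE of the
# isotropic-kernel reduction — a `≤ 11`-square family exists only if a REDUCED (pure, non-zero
# weights) family exists (`--supports` stmt-ValiantsHypothesis-5674 `SdcSuperquadratic`; (8,8) column
# of the size tables; memo `NOTE-p6g15-5674-IR12-reduction.md` §3–§11)

**Theorem** (`exists_reduced_of_design`).  If `Σ_r c_r t_r((a,b),(y₂,y₃))² = per (a; b; y₂; y₃)`
has a solution with `|ι| ≤ 11` bilinear `t_r` over a field of characteristic zero, then there are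
an index type `κ` with `|κ| ≤ |ι|`, NON-ZERO weights `c' : κ → K` and bilinear `t'_r` with
`Σ_r c'_r (t'_r((0,b),(y₂,0)) + t'_r((a,0),(0,y₃)))² = per (a; b; y₂; y₃)
   - 2 Σ_r c'_r t'_r((a,0),(y₂,0)) t'_r((0,b),(0,y₃))`  for all `a, b, y₂, y₃`
(drop the zero weights, `PureReduction.pure_reduction`, and undo the `y₂ ↔ y₃` mirror by
`TenPairs.hJ_yswap`).  Contrapositive (`no_design_of_no_reduced`): the cells `(8,8,10)`,
`(8,8,11)` (`IR10`, `IR11` of `SymPencilSdcPerFourCellEightEight`) follow from the single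
REDUCED PROBLEM "no such `(κ, c', t')` with `|κ| ≤ 11`" = P1 (correction zero: pure per-designs;
tree interface `PureSymm.false_of_allX_of_symmIso`) ∪ R2 (correction non-zero) of the memo — BOTH
OPEN.  Honest framing: a conditional reduction, fully formal up to here; no cell closes; the
window `27 ≤ sdc(per_4) ≤ 29`, the crux and `VP ≠ VNP` are untouched.  No definitions, no named
facts. [folklore]
-/

noncomputable section

-- single-conjunct layout: Sub = Summit, duplicated namespace component intended
set_option linter.dupNamespace false

namespace Summit.ValiantsHypothesis.ValiantsHypothesis.Theorems.SymPencilPerFourInnerRankCapstone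

open Matrix Finset Module
open Summit.ValiantsHypothesis.ValiantsHypothesis.Theorems.SymPencilPerFourInnerRankRows
open Summit.ValiantsHypothesis.ValiantsHypothesis.Theorems.SymPencilPerFourInnerRankTenPairs
open Summit.ValiantsHypothesis.ValiantsHypothesis.Theorems.SymPencilPerFourInnerRankPureReduction

universe u v

variable {K : Type u} [Field K]

/-- **Every `≤ 11`-square family yields a reduced family.**  See the module docstring.
[folklore] -/
theorem exists_reduced_of_design [CharZero K] {ι : Type v} [Fintype ι] [DecidableEq ι]
    (hι : Fintype.card ι ≤ 11) (c : ι → K)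
    (t : ι → (((Fin 4 → K) × (Fin 4 → K)) →ₗ[K] ((Fin 4 → K) × (Fin 4 → K)) →ₗ[K] K))
    (hJ : ∀ a b y₂ y₃ : Fin 4 → K,
      ∑ r, c r * (t r (a, b) (y₂, y₃)) ^ 2 = (Matrix.of ![a, b, y₂, y₃]).permanent) :
    ∃ (κ : Type v) (_ : Fintype κ) (_ : DecidableEq κ) (c' : κ → K)
      (t' : κ → (((Fin 4 → K) × (Fin 4 → K)) →ₗ[K] ((Fin 4 → K) × (Fin 4 → K)) →ₗ[K] K)),
      Fintype.card κ ≤ Fintype.card ι ∧ (∀ r, c' r ≠ 0) ∧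
      ∀ a b y₂ y₃ : Fin 4 → K,
        ∑ r, c' r * (t' r (0, b) (y₂, 0) + t' r (a, 0) (0, y₃)) ^ 2 =
          (Matrix.of ![a, b, y₂, y₃]).permanent
            - 2 * ∑ r, c' r * t' r (a, 0) (y₂, 0) * t' r (0, b) (0, y₃) := by
  classical
  -- drop the zero weights
  let κ := {r : ι // c r ≠ 0}
  let c₁ : κ → K := fun r => c r.1
  let t₁ : κ → (((Fin 4 → K) × (Fin 4 → K)) →ₗ[K] ((Fin 4 → K) × (Fin 4 → K)) →ₗ[K] K) :=
    fun r => t r.1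
  have hκ : Fintype.card κ ≤ Fintype.card ι := Fintype.card_subtype_le _
  have hc₁ : ∀ r : κ, c₁ r ≠ 0 := fun r => r.2
  have hsum : ∀ f : ι → K, ∑ r : κ, c r.1 * f r.1 = ∑ r, c r * f r := by
    intro f
    have h1 : ∑ r : κ, c r.1 * f r.1 =
        ∑ r ∈ Finset.univ.filter (fun r => c r ≠ 0), c r * f r :=
      (Finset.sum_subtype (Finset.univ.filter (fun r => c r ≠ 0)) (fun r => by simp)
        (fun r => c r * f r)).symm
    rw [h1, Finset.sum_filter]
    refine Finset.sum_congr rfl fun r _ => ?_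
    split_ifs with h
    · rfl
    · rw [not_not.1 h, zero_mul]
  have hJ₁ : ∀ a b y₂ y₃ : Fin 4 → K,
      ∑ r, c₁ r * (t₁ r (a, b) (y₂, y₃)) ^ 2 = (Matrix.of ![a, b, y₂, y₃]).permanent := by
    intro a b y₂ y₃
    rw [← hJ a b y₂ y₃]
    exact hsum fun r => (t r (a, b) (y₂, y₃)) ^ 2
  rcases pure_reduction (hκ.trans hι) c₁ hc₁ t₁ hJ₁ with h | h
  · exact ⟨κ, inferInstance, inferInstance, c₁, t₁, hκ, hc₁, h⟩
  · -- mirrored case: pass to the `y₂ ↔ y₃`-swapped family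
    refine ⟨κ, inferInstance, inferInstance, c₁,
      fun r => (t₁ r).compl₂ (LinearEquiv.prodComm K (Fin 4 → K) (Fin 4 → K)).toLinearMap,
      hκ, hc₁, fun a b y₂ y₃ => ?_⟩
    have h' := h a b y₃ y₂
    rw [per_swap_row₂₃] at h'
    simp only [LinearMap.compl₂_apply, LinearEquiv.coe_coe, LinearEquiv.prodComm_apply,
      Prod.swap_prod_mk]
    rw [show (∑ x, c₁ x * (t₁ x (0, b) (0, y₂) + t₁ x (a, 0) (y₃, 0)) ^ 2) =
        ∑ x, c₁ x * (t₁ x (a, 0) (y₃, 0) + t₁ x (0, b) (0, y₂)) ^ 2 from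
      Finset.sum_congr rfl fun r _ => by ring, h']
    congr 1; congr 1
    exact Finset.sum_congr rfl fun r _ => by ring

/-- **Contrapositive: no reduced family ⇒ no family** (the (8,8)-column cells follow from the
reduced problem). [folklore] -/
theorem no_design_of_no_reduced [CharZero K] {ι : Type v} [Fintype ι] [DecidableEq ι]
    (hι : Fintype.card ι ≤ 11)
    (H : ∀ (κ : Type v) [Fintype κ] [DecidableEq κ], Fintype.card κ ≤ Fintype.card ι →
      ∀ (c' : κ → K)
        (t' : κ → (((Fin 4 → K) × (Fin 4 → K)) →ₗ[K] ((Fin 4 → K) × (Fin 4 → K)) →ₗ[K] K)),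
        (∀ r, c' r ≠ 0) →
        ¬ ∀ a b y₂ y₃ : Fin 4 → K,
          ∑ r, c' r * (t' r (0, b) (y₂, 0) + t' r (a, 0) (0, y₃)) ^ 2 =
            (Matrix.of ![a, b, y₂, y₃]).permanent
              - 2 * ∑ r, c' r * t' r (a, 0) (y₂, 0) * t' r (0, b) (0, y₃)) :
    ¬ ∃ (c : ι → K)
        (t : ι → (((Fin 4 → K) × (Fin 4 → K)) →ₗ[K] ((Fin 4 → K) × (Fin 4 → K)) →ₗ[K] K)),
        ∀ a b y₂ y₃ : Fin 4 → K,
          ∑ r, c r * (t r (a, b) (y₂, y₃)) ^ 2 = (Matrix.of ![a, b, y₂, y₃]).permanent := by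
  rintro ⟨c, t, hJ⟩
  obtain ⟨κ, _, _, c', t', hκ, hc', h⟩ := exists_reduced_of_design hι c t hJ
  exact H κ hκ c' t' hc' h

end Summit.ValiantsHypothesis.ValiantsHypothesis.Theorems.SymPencilPerFourInnerRankCapstone

end
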